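import Literature.NumberTheory.EllipticCurves.LiTianYanZhu2025.CyclotomicMainConjectureOrderProofs
import Literature.NumberTheory.EllipticCurves.Hida2010MuInvariant.AnticyclotomicKatzBranchMuInvariant
import Literature.NumberTheory.GaloisRepresentations.WeakAbelianDirectSummandProofs
import Literature.NumberTheory.GaloisRepresentations.WeakAbelianDirectSummandTwistProofs
import Summits.BirchSwinnertonDyer.BirchSwinnertonDyer.Theorems.PrintCf2SplitBadTwoQuadraticPartHecke
import HarnessLib

/-!
# Route `PrintCf2RubinValueTwo` (road α at the split additive prime 2), crux
# `TwoVariableMainConjAtSplitTwo` (stmt-BirchSwinnertonDyer-23720, S3a of the v10.3 lead skeleton):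
# the ANALYTIC birth stub `stub_measureExists` — the two-variable Katz–de Shalit measure of the
# `θ_K⁻¹`-twist EXISTS at `p = 2` in the frame `IsKatzMeasure₂`, granted de Shalit's parity-free
# two-variable existence fact (II.4.17 (54) with Thm. 4.14)

Cell `bsd-print-cf2` (HOME `run/shared/lean/pub/bsd-print-cf2/`), width seat `bsd-line-cf2c-w4` g0
(AUTOFILL #2 PART 2 (1), 2026-08-28T23:57:14Z). The planner's BC3 birth skeleton of the crux
(`Cruxes/TwoVariableMainConjAtSplitTwo`, evidence `TwoVariableMainConjAtSplitTwo_birth.lean`,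
sha 978ee3c9be009d8b) splits item 23720 into

* `MeasureExists` (ANALYTIC): Katz–de Shalit period data `(Ω ≠ 0, δ² = ±d_K, Ω_p ∈ R₀ˣ)` and, for
  every generator pair `(κ₁, κ₂; γ₁, γ₂)` of the `ℤ₂²`-tower, every finite-order framed character `θ`
  (`θⁿ = 1`) with Hecke avatar `θ_K` (`KellerYin2024.IsHeckeCharOf ι θ θ_K`) ramified exactly on
  `S ∌ v, v̄`, a two-variable `G₂ ∈ 𝒪_{ℂ₂}⟦T₁⟧⟦T₂⟧` with
  `IsKatzMeasure₂ ι v v̄ S κ₁ κ₂ γ₁⁻¹ γ₂⁻¹ θ_K⁻¹ Ω δ Ω_p G₂`;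
* `MainConjForMeasure` (ALGEBRAIC, the main conjecture proper).

THIS FILE proves the first stub MODULO ONE PUBLISHED NAMED FACT already in the tree:
`DeShalit1987.thmII417_exists_katzSheet` (de Shalit 1987 II.4.17 (54) with Thm. 4.14 (36), Thm. 4.12 and
§4.16 (50): the two-variable sheet of `L_{p,𝔣}` exists at every split prime, `p = 2` INCLUDED — "`1 +
4ℤ₂` if `p = 2`", II.2.7, the `p = 2` remark in the proof of 4.14). The composition is

1. `exists_isKatzMeasure₂_invGenerators` (bridge `IsKatzSheet ↔ IsKatzMeasure₂`,
   `KatzTwoVariableBridgeProofs`; inverse generators via the `(−1)`-unit twists of the pair,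
   `LiTianYanZhu2025/CyclotomicMainConjectureOrderProofs` §2): period data and, for every algebraic
   `λ` unramified off `S ∪ {v, v̄}` and every generator pair, an `H` with
   `IsKatzMeasure₂ ι v v̄ S κ₁ κ₂ γ₁⁻¹ γ₂⁻¹ λ Ω δ Ω_p H`;
2. `isFiniteOrder_of_isHeckeCharOf_of_pow_eq_one` (this file): ANY Hecke character `θ_K` attached by
   `IsHeckeCharOf ι θ` to a finite-order framed `θ` (`θⁿ = 1`, `n > 0`, any `p`, any number field) has
   FINITE ORDER — primitive Artin reciprocity gives a finite-order witness `ω` whose ramification is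
   exactly that of `θ` (`PrintCf2.QuadraticPart.exists_heckeChar_of_pow_eq_one`), so `θ` is unramified
   almost everywhere (Tate, `HeckeCharacter.isUnramifiedAt_cofinite_holds ω`), and the Hecke character
   of `θ` is unique (`KellerYin2024.IsHeckeCharOf.unique`, Cassels–Fröhlich VII §4 Prop. 4.1); hence
   `θ_K⁻¹` is algebraic (`IsFiniteOrder.isAlgebraic`, `IsAlgebraic.inv`);
3. `θ_K⁻¹` is unramified off `S ∪ {v, v̄}` (`IsUnramifiedAt.inv'`).

HONEST FRAMING. `measureExists_of_katzSheet` is CONDITIONAL on the named fact (hypothesis BY NAME;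
the gate records `proof.conditional`); the registered stub `stub_measureExists : MeasureExists` itself
is NOT closed by this file — closing it unconditionally means formalising de Shalit's elliptic-unit
measure (the +1 declared debt of `KatzTwoVariablePAdicLFunction.lean`). The route's print bundle
`PrintsRubinTwo` (item 23725) carries only the ONE-variable fact `DeShalit1987.thmII414_exists_katzBranch`,
which does not yield the two-variable frame (a character of `ℤ₂²` need not factor through a
`ℤ₂`-quotient). The class-number binder `¬ 2 ∣ h_K` and the exact-ramification binder
`∀ w ∈ S, ¬ θ_K.IsUnramifiedAt w` of the stub are not used. Nothing here concerns an elliptic curve;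
BSD is not proved by any of this; beyond-print theorem: no.

References: [deShalit1987] II.4.17 (54) (p. 78), II Thm. 4.14 (36) (p. 71), Thm. 4.12 + Remarks
(p. 66–67), II.2.7 (p. 48); [CasselsFrohlichANT1967] VII §4 Prop. 4.1, §5.1 (A); [NeukirchANT1999]
VII (10.6); [TateThesis1967] Lemma 3.2.1; [Rubin1991] §4 (the frame `IsKatzMeasure₂`).
-/

-- the summit namespace `Summit.BirchSwinnertonDyer.BirchSwinnertonDyer` repeats the problem name by design (D-0017)
set_option linter.dupNamespace false
set_option autoImplicit false

noncomputable section

open scoped Classical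

open Filter NumberField IsDedekindDomain Field
  Literature.NumberTheory.GaloisRepresentations Literature.NumberTheory.EllipticCurves
  Literature.NumberTheory.EllipticCurves.KellerYin2024
  Literature.NumberTheory.EllipticCurves.DeShalit1987

namespace Summit.BirchSwinnertonDyer.BirchSwinnertonDyer.Theorems.PrintCf2RubinValueTwo.MeasureExists

/-! ## §1 A Hecke character attached to a finite-order framed character has finite order -/

section FiniteOrder

variable {K : Type} [Field K] [NumberField K] {p : ℕ} [Fact p.Prime]

/-- **A finite-order framed character is unramified almost everywhere**: for `θ : Γ_K → GL₁(𝓞)`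
continuous with `θⁿ = 1`, `n > 0`, the set of finite places where `θ` ramifies is finite — read off
the finite-order Hecke character `ω` with the SAME ramification produced by primitive Artin
reciprocity (`PrintCf2.QuadraticPart.exists_heckeChar_of_pow_eq_one`) and Tate's finiteness of the
ramification of a Hecke character (`HeckeCharacter.isUnramifiedAt_cofinite_holds`).
[cite: TateThesis1967, Lemma 3.2.1] [cite: NeukirchANT1999, Ch. VII §10 Thm. (10.6)] -/
theorem eventually_isUnramifiedAt_of_pow_eq_one (ι : PadicAlgCl p ≃+* ℂ) {S : Set (PadicAlgCl p)}
    (θ : FramedGaloisRep K (padicCoeffIntegers S) 1) {n : ℕ} (hn : 0 < n)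
    (hθ : ∀ σ : absoluteGaloisGroup K, θ σ ^ n = 1) :
    ∀ᶠ w : HeightOneSpectrum (𝓞 K) in cofinite, θ.IsUnramifiedAt w := by
  obtain ⟨ω, -, -, hωunr⟩ := PrintCf2.QuadraticPart.exists_heckeChar_of_pow_eq_one S ι θ hn hθ
  exact (HeckeCharacter.isUnramifiedAt_cofinite_holds ω).mono fun w hw ↦ (hωunr w).mp hw

/-- **Every Hecke character attached to a finite-order framed character has finite order** (any
prime `p`, any number field, any exponent `n > 0`): if `θ : Γ_K → GL₁(𝓞)` satisfies `θⁿ = 1` and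
`θ_K` is ANY Hecke character with `KellerYin2024.IsHeckeCharOf ι θ θ_K`, then `θ_K` has finite order —
the finite-order witness of primitive Artin reciprocity IS `θ_K` by the uniqueness of the Hecke
character of a character unramified almost everywhere (`KellerYin2024.IsHeckeCharOf.unique`,
Cassels–Fröhlich VII §4 Prop. 4.1). [cite: CasselsFrohlichANT1967, Ch. VII §4 Prop. 4.1 and §5.1 Main Theorem (A)] -/
theorem isFiniteOrder_of_isHeckeCharOf_of_pow_eq_one (ι : PadicAlgCl p ≃+* ℂ) {S : Set (PadicAlgCl p)}
    {θ : FramedGaloisRep K (padicCoeffIntegers S) 1} {n : ℕ} (hn : 0 < n)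
    (hθ : ∀ σ : absoluteGaloisGroup K, θ σ ^ n = 1) {θK : HeckeCharacter K}
    (hθK : IsHeckeCharOf ι θ θK) : θK.IsFiniteOrder := by
  obtain ⟨ω, hfin, hω, hωunr⟩ := PrintCf2.QuadraticPart.exists_heckeChar_of_pow_eq_one S ι θ hn hθ
  have hθunr : ∀ᶠ w : HeightOneSpectrum (𝓞 K) in cofinite, θ.IsUnramifiedAt w :=
    (HeckeCharacter.isUnramifiedAt_cofinite_holds ω).mono fun w hw ↦ (hωunr w).mp hw
  rwa [hθK.unique ι hθunr hω]

/-- The inverse of the Hecke character of a finite-order framed character is ALGEBRAIC (finite order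
⟹ type `A₀` with `(p_w, q_w) = 0`; inverses of algebraic characters are algebraic) — the binder
`lam.IsAlgebraic` of de Shalit's existence fact at `lam = θ_K⁻¹`. [cite: CasselsFrohlichANT1967, Ch. VII §4 Prop. 4.1] -/
theorem isAlgebraic_inv_of_isHeckeCharOf_of_pow_eq_one (ι : PadicAlgCl p ≃+* ℂ) {S : Set (PadicAlgCl p)}
    {θ : FramedGaloisRep K (padicCoeffIntegers S) 1} {n : ℕ} (hn : 0 < n)
    (hθ : ∀ σ : absoluteGaloisGroup K, θ σ ^ n = 1) {θK : HeckeCharacter K}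
    (hθK : IsHeckeCharOf ι θ θK) : θK⁻¹.IsAlgebraic :=
  (isFiniteOrder_of_isHeckeCharOf_of_pow_eq_one ι hn hθ hθK).isAlgebraic.inv

end FiniteOrder

/-! ## §2 The analytic stub `MeasureExists` of crux 23720, granted de Shalit II.4.17 (parity-free) -/

/-- **`stub_measureExists` of the birth skeleton of crux `TwoVariableMainConjAtSplitTwo`
(stmt-BirchSwinnertonDyer-23720), GRANTED `DeShalit1987.thmII417_exists_katzSheet`** — the statement
after the hypothesis is the registered stub signature `MeasureExists` VERBATIM: for every imaginary
quadratic `K` of odd class number with `2 = v v̄` split and `ι` pinned to `v`, there are Katz–de Shalit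
period data `Ω ≠ 0`, `δ² = ±d_K`, `Ω_p ∈ R₀ˣ` such that for every generator pair `(κ₁, κ₂; γ₁, γ₂)` of the
`ℤ₂²`-tower, every finite-order framed `θ` (`θⁿ = 1`, `n > 0`) with Hecke avatar `θ_K`
(`IsHeckeCharOf ι θ θ_K`) ramified exactly on `S ∌ v, v̄`, some `G₂ ∈ 𝒪_{ℂ₂}⟦T₁⟧⟦T₂⟧` satisfies
`IsKatzMeasure₂ ι v v̄ S κ₁ κ₂ γ₁⁻¹ γ₂⁻¹ θ_K⁻¹ Ω δ Ω_p G₂`. Proof: de Shalit's parity-free two-variable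
existence fact read in the `IsKatzMeasure₂` frame at the inverse generators
(`exists_isKatzMeasure₂_invGenerators`) at the algebraic twist `λ = θ_K⁻¹` (§1), which is unramified
off `S ∪ {v, v̄}` (`IsUnramifiedAt.inv'`). CONDITIONAL on the named fact (module docstring); the
class-number and exact-ramification binders are carried, not used.
[cite: deShalit1987, II.4.17 (54) and the closing sentence (p. 78), II Thm. 4.14 (36) (p. 71), Thm. 4.12 with Remarks (i), (iii), (iv) (p. 66–67), II.2.7 (p. 48)] -/
theorem measureExists_of_katzSheet (hdS : DeShalit1987.thmII417_exists_katzSheet) :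
    open scoped Classical in
    open NumberField IsDedekindDomain Field WeierstrassCurve in
    open Literature.NumberTheory.GaloisRepresentations Literature.NumberTheory.EllipticCurves in
    open Literature.NumberTheory.EllipticCurves.Rank1Residual in
    open Literature.NumberTheory.EllipticCurves.DeShalit1987 in
    ∀ (K : Type) [Field K] [NumberField K], IsImaginaryQuadratic K →
    ¬ 2 ∣ NumberField.classNumber K →
    ∀ (ι : PadicAlgCl 2 ≃+* ℂ) (v vbar : HeightOneSpectrum (𝓞 K)),
      ((2 : ℕ) : 𝓞 K) ∈ v.asIdeal → ((2 : ℕ) : 𝓞 K) ∈ vbar.asIdeal → vbar ≠ v →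
      (∀ (w : InfinitePlace K) (k : 𝓞 K), k ∈ v.asIdeal ↔ ‖ι.symm (w.embedding (k : K))‖ < 1) →
    ∃ (Ω δ : ℂ) (Ωp : (unrIntegers 2)ˣ), Ω ≠ 0 ∧
      (δ ^ 2 = (NumberField.discr K : ℂ) ∨ δ ^ 2 = -(NumberField.discr K : ℂ)) ∧
    ∀ (κ₁ κ₂ : ZpExtension K 2) (γ₁ γ₂ : absoluteGaloisGroup K),
      ZpExtension.IsTopGeneratorPair κ₁ κ₂ γ₁ γ₂ →
    ∀ (θ : FramedGaloisRep K (padicCoeffIntegers (∅ : Set (PadicAlgCl 2))) 1) (n : ℕ),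
      0 < n → (∀ σ : absoluteGaloisGroup K, θ σ ^ n = 1) →
    ∀ (θK : HeckeCharacter K), KellerYin2024.IsHeckeCharOf ι θ θK →
    ∀ (S : Finset (HeightOneSpectrum (𝓞 K))), v ∉ S → vbar ∉ S →
      (∀ w ∈ S, ¬ θK.IsUnramifiedAt w) →
      (∀ w : HeightOneSpectrum (𝓞 K), w ∉ S → w ≠ v → w ≠ vbar → θK.IsUnramifiedAt w) →
    ∃ G₂ : PowerSeries (PowerSeries (PadicComplexInt 2)),
      IsKatzMeasure₂ ι v vbar S κ₁ κ₂ γ₁⁻¹ γ₂⁻¹ θK⁻¹ Ω δ ((Ωp : unrIntegers 2) : ℂ_[2]) G₂ := by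
  intro K _ _ hK _hcl ι v vbar hv hvbar hne hι
  obtain ⟨Ω, δ, Ωp, hΩ, hδ, hall⟩ :=
    exists_isKatzMeasure₂_invGenerators (p := 2) hdS hK ι v vbar hv hvbar hne hι
  refine ⟨Ω, δ, Ωp, hΩ, hδ, ?_⟩
  intro κ₁ κ₂ γ₁ γ₂ hpair θ n hn hθ θK hθK S hvS hvbarS _hram hunr
  have halg : θK⁻¹.IsAlgebraic := isAlgebraic_inv_of_isHeckeCharOf_of_pow_eq_one ι hn hθ hθK
  have hunr' : ∀ w : HeightOneSpectrum (𝓞 K), w ∉ S → w ≠ v → w ≠ vbar → θK⁻¹.IsUnramifiedAt w :=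
    fun w hw hwv hwvbar ↦ (hunr w hw hwv hwvbar).inv'
  exact hall S hvS hvbarS θK⁻¹ halg hunr' κ₁ κ₂ γ₁ γ₂ hpair

end Summit.BirchSwinnertonDyer.BirchSwinnertonDyer.Theorems.PrintCf2RubinValueTwo.MeasureExists

end
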